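import Summits.CriticalPhenomena.PercolationContinuityZ3.Theorems.PercNearOneGluingNoHeavyLowerTailSahiCombTriWCorCore
import Summits.CriticalPhenomena.PercolationContinuityZ3.Theorems.PercNearOneGluingNoHeavyLowerTailSahiCombTriWThreshold
import Summits.CriticalPhenomena.PercolationContinuityZ3.Theorems.PercNearOneGluingNoHeavyLowerTailAntiBandDegenerate

/-!
# BRIDGE: the outer-layer Kleitman conjecture `ThresholdCorNonneg` (P5 lane) IS the anti-band inequality (AB_l) of lane prim-ineq-gen-4

Support file of the one-cut programme (crux `NoHeavyLowerTail`, stmt-CriticalPhenomena-4575; cell `prim-masterthm`, seat P5 gen 24; memo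
`FROM-prim-masterthm-p5-g24-SANDWICH.md` §12).  Two lanes met the same inequality from opposite sides.  P5 (this lane): `TriWIneq` for a symmetric THRESHOLD test set
`P_k = {#w ≥ k}`, `2k > n`, follows from `Cor_{P_k}(A,B) ≥ 0` for all up-sets (`…TriWCorNonneg`, `…TriWThreshold`: conjecture `ThresholdCorNonneg` = OLK).  prim-ineq-gen-4
(gens 19–21, files `…NoHeavyLowerTailAntiBand*`): the ANTI-BAND inequality
  (AB_l)  `#{s ∈ A ∩ Bᶜˢ | #s < l ∨ #sᶜ < l} ≤ #{s ∈ A ∩ B | #s < l ∨ #sᶜ < l}`  for up-sets `A, B`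
("odd Harris on Hamming balls"), with the SHIFTING REDUCTION formalised (`AntiBandShift.antiBand_compression_swap_le`, `AntiBandShiftReduction`), the case `l = 2` in every
dimension (`AntiBandJ`), the degenerate case (`AntiBandDegenerate.antiBand_of_no_positive`) and a determinant criterion (`AntiBandDetCriterion`).
THIS FILE identifies the two: `refl = (·)ᶜˢ` definitionally, and for `n < 2k`, `l = n + 1 − k`,
  **`corP_threshold_eq_antiBand`: `Cor_{P_k}(A,B) = #{s ∈ A ∩ B | outer_l s} − #{s ∈ A ∩ Bᶜˢ | outer_l s}`**,
hence **`thresholdCorNonneg_iff_antiBand`** (OLK ⟺ (AB) for all `n < 2k`, `l = n+1−k`), **`triW_nonneg_threshold_of_antiBand`** ((AB_l) on one ground type ⟹ `TriWIneq` for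
`P_{n+1−l}` on every index cube), and, through the other lane's degenerate case, **`corP_threshold_nonneg_of_noPositive`**.  So every (AB_l) theorem of prim-ineq-gen-4 is a
`TriWIneq` theorem for the threshold `{#w ≥ n+1−l}`, and the P5 evidence (OLK exhaustive for n ≤ 6 via 1173 left-shifted families, explicit co-covering injections) is evidence
for (AB).  No new definitions; std axioms. [this work]
-/

namespace Summit.CriticalPhenomena.PercolationContinuityZ3.Theorems

namespace FiveUpSet

open Finset
open scoped FinsetFamily

variable {β γ : Type} [DecidableEq β] [Fintype β] [DecidableEq γ] [Fintype γ]

omit [Fintype γ] in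
/-- The antipodal image `refl` of this programme is Mathlib's family of complements `(·)ᶜˢ`, definitionally. [this work] -/
theorem refl_eq_compls [Fintype γ] (A : Finset (Finset γ)) : refl A = Aᶜˢ := rfl

/-- The outer layers of a threshold family: for `n < 2k` and any `s`, `s ∈ P_k ∪ refl P_k ↔ #s < n+1−k ∨ #sᶜ < n+1−k`. [this work] -/
theorem mem_threshold_union_refl_iff (k : ℕ) (s : Finset γ) :
    s ∈ thresholdFamily γ k ∪ refl (thresholdFamily γ k) ↔ (s.card < Fintype.card γ + 1 - k ∨ sᶜ.card < Fintype.card γ + 1 - k) := by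
  rw [mem_union, mem_refl, mem_thresholdFamily, mem_thresholdFamily]
  have h1 : sᶜ.card = Fintype.card γ - s.card := Finset.card_compl s
  have h2 : s.card ≤ Fintype.card γ := card_le_univ s
  omega

/-- For `n < 2k` the threshold family `P_k` is antipode-free: `Disjoint P_k (refl P_k)`. [this work] -/
theorem disjoint_threshold_refl (k : ℕ) (hk : Fintype.card γ < 2 * k) :
    Disjoint (thresholdFamily γ k) (refl (thresholdFamily γ k)) := by
  rw [Finset.disjoint_left]
  intro s hs hs'
  rw [mem_thresholdFamily] at hs
  rw [mem_refl, mem_thresholdFamily] at hs'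
  have h1 : sᶜ.card = Fintype.card γ - s.card := Finset.card_compl s
  have h2 : s.card ≤ Fintype.card γ := card_le_univ s
  omega

/-- Local copy of the `T`-form of `Cor_P` for an antipode-free `P` (proved in `…TriWCorCoCover` as `corP_eq_card_sub_card_of_disjoint`; repeated privately so that this
file does not depend on that module). [this work] -/
private theorem corP_T_form {P : Finset (Finset γ)} (hP : Disjoint P (refl P)) (A B : Finset (Finset γ)) :
    corP P A B = (((P ∪ refl P) ∩ A ∩ B).card : ℤ) - (((P ∪ refl P) ∩ refl A ∩ B).card : ℤ) := by
  have hr : (P ∩ A ∩ refl B).card = (refl P ∩ refl A ∩ B).card := by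
    rw [← card_refl (P ∩ A ∩ refl B), refl_inter, refl_inter, refl_refl]
  unfold corP
  rw [← card_refl_inter_inter, hr]
  have h1 : (P ∪ refl P) ∩ A ∩ B = (P ∩ A ∩ B) ∪ (refl P ∩ A ∩ B) := by
    ext w
    simp only [mem_inter, mem_union]
    tauto
  have h2 : (P ∪ refl P) ∩ refl A ∩ B = (P ∩ refl A ∩ B) ∪ (refl P ∩ refl A ∩ B) := by
    ext w
    simp only [mem_inter, mem_union]
    tauto
  have d1 : Disjoint (P ∩ A ∩ B) (refl P ∩ A ∩ B) :=
    hP.mono (inter_subset_left.trans inter_subset_left) (inter_subset_left.trans inter_subset_left)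
  have d2 : Disjoint (P ∩ refl A ∩ B) (refl P ∩ refl A ∩ B) :=
    hP.mono (inter_subset_left.trans inter_subset_left) (inter_subset_left.trans inter_subset_left)
  rw [h1, h2, card_union_of_disjoint d1, card_union_of_disjoint d2]
  push_cast
  ring

/-- **`Cor_{P_k}(A,B)` in anti-band form**: for `n < 2k` and `l := n + 1 − k`,
`Cor_{P_k}(A,B) = #{s ∈ A ∩ B | #s < l ∨ #sᶜ < l} − #{s ∈ A ∩ Bᶜˢ | #s < l ∨ #sᶜ < l}` (any families `A, B`). [this work] -/
theorem corP_threshold_eq_antiBand (k : ℕ) (hk : Fintype.card γ < 2 * k) (A B : Finset (Finset γ)) :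
    corP (thresholdFamily γ k) A B
      = (((A ∩ B).filter fun s => s.card < Fintype.card γ + 1 - k ∨ sᶜ.card < Fintype.card γ + 1 - k).card : ℤ)
        - (((A ∩ Bᶜˢ).filter fun s => s.card < Fintype.card γ + 1 - k ∨ sᶜ.card < Fintype.card γ + 1 - k).card : ℤ) := by
  rw [corP_comm, corP_T_form (disjoint_threshold_refl k hk)]
  have e1 : (thresholdFamily γ k ∪ refl (thresholdFamily γ k)) ∩ B ∩ A
      = (A ∩ B).filter fun s => s.card < Fintype.card γ + 1 - k ∨ sᶜ.card < Fintype.card γ + 1 - k := by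
    ext s
    rw [mem_inter, mem_inter, mem_filter, mem_inter, mem_threshold_union_refl_iff]
    tauto
  have e2 : (thresholdFamily γ k ∪ refl (thresholdFamily γ k)) ∩ refl B ∩ A
      = (A ∩ Bᶜˢ).filter fun s => s.card < Fintype.card γ + 1 - k ∨ sᶜ.card < Fintype.card γ + 1 - k := by
    ext s
    rw [mem_inter, mem_inter, mem_filter, mem_inter, mem_threshold_union_refl_iff, ← refl_eq_compls]
    tauto
  rw [e1, e2]

/-- **OLK ⟺ (AB).**  `ThresholdCorNonneg` holds iff the anti-band inequality `#{s ∈ A ∩ Bᶜˢ | outer} ≤ #{s ∈ A ∩ B | outer}` (`outer s :↔ #s < n+1−k ∨ #sᶜ < n+1−k`)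
holds for every finite ground type, every `k` with `n < 2k` and all up-sets `A, B`. [this work] -/
theorem thresholdCorNonneg_iff_antiBand :
    ThresholdCorNonneg ↔
    (∀ (γ : Type) [DecidableEq γ] [Fintype γ] (k : ℕ), Fintype.card γ < 2 * k →
      ∀ A B : Finset (Finset γ), IsUpperSet (A : Set (Finset γ)) → IsUpperSet (B : Set (Finset γ)) →
        ((A ∩ Bᶜˢ).filter fun s => s.card < Fintype.card γ + 1 - k ∨ sᶜ.card < Fintype.card γ + 1 - k).card
          ≤ ((A ∩ B).filter fun s => s.card < Fintype.card γ + 1 - k ∨ sᶜ.card < Fintype.card γ + 1 - k).card) := by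
  constructor
  · intro h γ _ _ k hk A B hA hB
    have h1 := h γ k hk A B hA hB
    rw [corP_threshold_eq_antiBand k hk] at h1
    omega
  · intro h γ _ _ k hk A B hA hB
    rw [corP_threshold_eq_antiBand k hk]
    have h1 := h γ k hk A B hA hB
    omega

/-- **(AB_l) on one ground type ⟹ `TriWIneq` for the threshold `P_k`, `k = n+1−l`**: if the anti-band inequality with parameter `n+1−k` holds for all up-sets of
`Finset γ` (`n = #γ < 2k`), then `0 ≤ triW (thresholdFamily γ k) F G` for every index cube and all monotone families of up-sets. [this work] -/
theorem triW_nonneg_threshold_of_antiBand (k : ℕ) (hk : Fintype.card γ < 2 * k)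
    (hAB : ∀ A B : Finset (Finset γ), IsUpperSet (A : Set (Finset γ)) → IsUpperSet (B : Set (Finset γ)) →
      ((A ∩ Bᶜˢ).filter fun s => s.card < Fintype.card γ + 1 - k ∨ sᶜ.card < Fintype.card γ + 1 - k).card
        ≤ ((A ∩ B).filter fun s => s.card < Fintype.card γ + 1 - k ∨ sᶜ.card < Fintype.card γ + 1 - k).card)
    (F G : Finset β → Finset (Finset γ))
    (hF : ∀ x, IsUpperSet (F x : Set (Finset γ))) (hG : ∀ x, IsUpperSet (G x : Set (Finset γ)))
    (hFm : Monotone F) (hGm : Monotone G) :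
    0 ≤ triW (thresholdFamily γ k) F G := by
  refine triW_nonneg_of_corP_nonneg (isUpperSet_thresholdFamily k) (fun A B hA hB => ?_) F G hF hG hFm hGm
  rw [corP_threshold_eq_antiBand k hk]
  have h1 := hAB A B hA hB
  omega

/-- **The degenerate case through the bridge** (prim-ineq-gen-4's `antiBand_of_no_positive`): if every member `s ∈ A` with `#s < n+1−k` has `sᶜ ∈ A` (no POSITIVE small
member), then `0 ≤ Cor_{P_k}(A,B)` for every up-set `B` (`n < 2k`). [this work] -/
theorem corP_threshold_nonneg_of_noPositive (k : ℕ) (hk : Fintype.card γ < 2 * k) {A B : Finset (Finset γ)}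
    (hA : IsUpperSet (A : Set (Finset γ))) (hB : IsUpperSet (B : Set (Finset γ)))
    (hneg : ∀ s ∈ A, s.card < Fintype.card γ + 1 - k → sᶜ ∈ A) : 0 ≤ corP (thresholdFamily γ k) A B := by
  rw [corP_threshold_eq_antiBand k hk]
  have h1 := AntiBandDegenerate.antiBand_of_no_positive (Fintype.card γ + 1 - k) A B hA hB hneg
  omega

end FiveUpSet

end Summit.CriticalPhenomena.PercolationContinuityZ3.Theorems
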